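import Mathlib
import HarnessLib

/-!
# Zhang (2022), §2 (2.15) and §5 p. 10: the smooth weight `ω(s)`, its Gaussian profile on the
# critical line, the Fourier relation used for (5.11), and `∫ ω(1/2+2πix) dx = 1` (Lemma 5.4 (ii))

Topic `Literature/NumberTheory/LFunctions/Zhang2022` (Landau–Siegel autopsy tree; verdict-neutral).
Y. Zhang, *Discrete mean estimates and the Landau–Siegel zero*, arXiv:2211.02515v1 (2022) — **an
unrefereed manuscript, a claimed result under adjudication** (cell pub-zhang: audit + repair census
of arXiv:2211.02515; no claim about Landau–Siegel).

Glossary (referee item 159): the source macro `\l` is `𝓛 = log D` ((2.1)); `𝓛₂ = 𝓛^{400}` ((2.15));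
`s₀ = 1/2 + 2πit₀` (§2); `ε = exp{−c𝓛^{10}}` (§4). In this file `𝓛₂` and `t₀` are free real
parameters `L₂`, `t₀` (the manuscript's values are not introduced), and `ι` is NOT used for `𝓛`.

Source text, §2 p. 5 [(2.15)]:

> We introduce the smooth weight
> `ω(s) = (√π/𝓛₂) exp{(s − s₀)²/(4𝓛₂²)}` with `𝓛₂ = 𝓛^{400}`,   (2.15)
> which is positive for `σ = 1/2`.

§5 p. 10, before Lemma 5.3:

> Note that `ω(1/2 + 2πix) = (√π/𝓛₂) exp{−(π(x − t₀)/𝓛₂)²} > 0.`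

§5, proof of Lemma 5.3 (case `x ≤ t₀^{1.02}`):

> By the relation `∫_{−∞}^{∞} exp{2πi(t₀ − x)u − 𝓛₂²u²} du = ω(1/2 + 2πix)` and Cauchy's theorem, …

§5, proof of Lemma 5.4 (ii):

> Since `∫₀^∞ ω(1/2 + 2πix) dx = 1 + O(ε)`, (ii) follows.

This file PROVES, for real parameters `L₂ > 0`, `t₀`:

* `SmoothWeight.omega_half_eq` — the Note, EXACT: `ω(1/2+2πix) = (√π/L₂)exp{−(π(x−t₀)/L₂)²}`
  (`omegaLine`), and `omegaLine_pos`; `omega_half_add_eq` / `omega_re_pos_of_re_eq_half` —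
  "(2.15) … positive for `σ = 1/2`" for every point `1/2 + it`;
* `SmoothWeight.integral_cexp_phase_eq_omega` — the Fourier relation, EXACT (Mathlib's
  `integral_cexp_quadratic`);
* `SmoothWeight.integral_omegaLine` — `∫_{−∞}^{∞} ω(1/2+2πix) dx = 1` EXACTLY, and the half-line
  form of Lemma 5.4 (ii) with an explicit tail in place of `O(ε)`:
  `1 − ½·exp{−(πt₀/L₂)²} ≤ ∫₀^∞ ω(1/2+2πix) dx ≤ 1` for `t₀ ≥ 0`
  (`integral_omegaLine_Ioi_le_one`, `one_sub_le_integral_omegaLine_Ioi`). With the manuscript's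
  `𝓛₂ = 𝓛^{400}` and `t₀` a larger power of `𝓛` ((2.8)) the tail is `≤ exp{−𝓛^{10}}`-small; that
  bookkeeping is not introduced here.

* `SmoothWeight.norm_omega_eq` — the modulus of (2.15) in closed form,
  `|ω(σ+it)| = (√π/L₂)exp{((σ−1/2)² − (t−2πt₀)²)/(4L₂²)}` ("a simple bound for `ω(s)`", §§6–8),
  and **(7.4)** `∫_{𝔍(z)} |ω(s) ds| ≪ 1` EXPLICITLY: `≤ 2π·exp{z²/(4L₂²)}` over the segment
  `𝔍(z) = [s₀+z−i𝓛₁, s₀+z+i𝓛₁]` for real `z` (`integral_norm_omega_segment_le`), `≤ 2πe^{1/4}` for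
  `|z| ≤ L₂` (`integral_norm_omega_segment_le_of_abs_le`).

Nothing about Theorems 1–2 of the source is stated or implied; nothing here bears on the cell's
verdict on (8.24). The abstract endgame structure `Zhang2022.EndgameData.omega_pos`
(`Section2Assembly`) takes "`ω(ρ) > 0`" as a hypothesis; `omega_re_pos_of_re_eq_half` is that
hypothesis for the concrete weight (2.15) at any `ρ` with `Re ρ = 1/2`.

## References

* Y. Zhang, arXiv:2211.02515v1 (2022), §2 (2.15); §5 p. 10 (Note before Lemma 5.3; proofs of
  Lemmas 5.3 and 5.4 (ii)); §7 p. 13 (7.4). [cite: Zhang2022LandauSiegel, §2 (2.15); §5 Lemma 5.3, Lemma 5.4; §7 (7.4)]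
-/

noncomputable section

open Complex Real Set MeasureTheory

namespace Literature.NumberTheory.LFunctions.Zhang2022

namespace SmoothWeight

/-- `s₀ = 1/2 + 2πit₀` (§2, recalled at §4 p. 8: "Recall that `s₀ = 1/2 + 2πit₀`").
[cite: Zhang2022LandauSiegel, §2, §4 p. 8] -/
def s0 (t₀ : ℝ) : ℂ := 1 / 2 + 2 * π * t₀ * I

/-- **(2.15)**: `ω(s) = (√π/𝓛₂) exp{(s − s₀)²/(4𝓛₂²)}`, with `𝓛₂ > 0` and `t₀` free real parameters.
[cite: Zhang2022LandauSiegel, §2 (2.15)] -/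
def omega (L₂ t₀ : ℝ) (s : ℂ) : ℂ :=
  ((Real.sqrt π / L₂ : ℝ) : ℂ) * cexp ((s - s0 t₀) ^ 2 / (4 * (L₂ : ℂ) ^ 2))

/-- The Gaussian profile of `ω` on the critical line, as a real number:
`(√π/𝓛₂) exp{−(π(x − t₀)/𝓛₂)²}` (the right side of the Note before Lemma 5.3).
[cite: Zhang2022LandauSiegel, §5 p. 10 (Note before Lemma 5.3)] -/
def omegaLine (L₂ t₀ x : ℝ) : ℝ := Real.sqrt π / L₂ * Real.exp (-(π * (x - t₀) / L₂) ^ 2)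

/-- Unfolding lemma for `s0`. [cite: Zhang2022LandauSiegel, §2] -/
lemma s0_def (t₀ : ℝ) : s0 t₀ = 1 / 2 + 2 * π * t₀ * I := rfl

/-- Unfolding lemma for `omega` ((2.15)). [cite: Zhang2022LandauSiegel, §2 (2.15)] -/
lemma omega_def (L₂ t₀ : ℝ) (s : ℂ) :
    omega L₂ t₀ s = ((Real.sqrt π / L₂ : ℝ) : ℂ) * cexp ((s - s0 t₀) ^ 2 / (4 * (L₂ : ℂ) ^ 2)) := rfl

/-- Unfolding lemma for `omegaLine`. [cite: Zhang2022LandauSiegel, §5 p. 10] -/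
lemma omegaLine_def (L₂ t₀ x : ℝ) :
    omegaLine L₂ t₀ x = Real.sqrt π / L₂ * Real.exp (-(π * (x - t₀) / L₂) ^ 2) := rfl

/-- **The Note before Lemma 5.3**, EXACT: `ω(1/2 + 2πix) = (√π/𝓛₂) exp{−(π(x − t₀)/𝓛₂)²}`.
[cite: Zhang2022LandauSiegel, §5 p. 10] -/
theorem omega_half_eq {L₂ : ℝ} (hL : L₂ ≠ 0) (t₀ x : ℝ) :
    omega L₂ t₀ (1 / 2 + 2 * π * x * I) = (omegaLine L₂ t₀ x : ℂ) := by
  have hL' : (L₂ : ℂ) ≠ 0 := ofReal_ne_zero.mpr hL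
  have h : ((1 / 2 : ℂ) + 2 * π * x * I - s0 t₀) ^ 2 / (4 * (L₂ : ℂ) ^ 2)
      = ((-(π * (x - t₀) / L₂) ^ 2 : ℝ) : ℂ) := by
    rw [s0_def]
    push_cast
    field_simp
    ring_nf
    rw [I_sq]
    ring
  rw [omega_def, h, omegaLine_def]
  push_cast
  rfl

/-- `ω(1/2 + 2πix) > 0`. [cite: Zhang2022LandauSiegel, §5 p. 10] -/
theorem omegaLine_pos {L₂ : ℝ} (hL : 0 < L₂) (t₀ x : ℝ) : 0 < omegaLine L₂ t₀ x :=
  mul_pos (div_pos (Real.sqrt_pos.mpr pi_pos) hL) (Real.exp_pos _)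

/-- `ω` at a general point of the critical line: `ω(1/2 + it) = (√π/𝓛₂) exp{−(t − 2πt₀)²/(4𝓛₂²)}`.
[cite: Zhang2022LandauSiegel, §2 (2.15)] -/
theorem omega_half_add_eq {L₂ : ℝ} (hL : L₂ ≠ 0) (t₀ t : ℝ) :
    omega L₂ t₀ (1 / 2 + t * I)
      = ((Real.sqrt π / L₂ * Real.exp (-((t - 2 * π * t₀) ^ 2 / (4 * L₂ ^ 2))) : ℝ) : ℂ) := by
  have hL' : (L₂ : ℂ) ≠ 0 := ofReal_ne_zero.mpr hL
  have h : ((1 / 2 : ℂ) + t * I - s0 t₀) ^ 2 / (4 * (L₂ : ℂ) ^ 2)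
      = ((-((t - 2 * π * t₀) ^ 2 / (4 * L₂ ^ 2)) : ℝ) : ℂ) := by
    rw [s0_def]
    push_cast
    field_simp
    ring_nf
    rw [I_sq]
    ring
  rw [omega_def, h]
  push_cast
  rfl

/-- **(2.15) "which is positive for `σ = 1/2`"**: at every `s` with `Re s = 1/2`, `ω(s)` is a
positive real number. [cite: Zhang2022LandauSiegel, §2 (2.15)] -/
theorem omega_re_pos_of_re_eq_half {L₂ : ℝ} (hL : 0 < L₂) (t₀ : ℝ) {s : ℂ} (hs : s.re = 1 / 2) :
    0 < (omega L₂ t₀ s).re ∧ (omega L₂ t₀ s).im = 0 := by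
  have hs' : s = 1 / 2 + s.im * I := by
    apply Complex.ext <;> simp [hs]
  rw [hs', omega_half_add_eq hL.ne' t₀ s.im, ofReal_re, ofReal_im]
  exact ⟨mul_pos (div_pos (Real.sqrt_pos.mpr pi_pos) hL) (Real.exp_pos _), rfl⟩


/-! ## The Fourier relation of the proof of Lemma 5.3 -/

/-- **The relation used for (5.11)**, EXACT:
`∫_{−∞}^{∞} exp{2πi(t₀ − x)u − 𝓛₂²u²} du = ω(1/2 + 2πix)` (`𝓛₂ > 0`).
[cite: Zhang2022LandauSiegel, §5 Lemma 5.3 (proof, "By the relation …")] -/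
theorem integral_cexp_phase_eq_omega {L₂ : ℝ} (hL : 0 < L₂) (t₀ x : ℝ) :
    ∫ u : ℝ, cexp (2 * π * I * (t₀ - x) * u - (L₂ : ℂ) ^ 2 * (u : ℂ) ^ 2)
      = omega L₂ t₀ (1 / 2 + 2 * π * x * I) := by
  have hb : (-(L₂ : ℂ) ^ 2).re < 0 := by
    have : (-(L₂ : ℂ) ^ 2) = ((-(L₂ ^ 2) : ℝ) : ℂ) := by push_cast; ring
    rw [this, ofReal_re]
    nlinarith
  have h1 : ∀ u : ℝ, cexp (2 * π * I * (t₀ - x) * u - (L₂ : ℂ) ^ 2 * (u : ℂ) ^ 2)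
      = cexp (-(L₂ : ℂ) ^ 2 * (u : ℂ) ^ 2 + (2 * π * I * (t₀ - x)) * u + 0) := by
    intro u; congr 1; ring
  simp_rw [h1]
  rw [integral_cexp_quadratic hb, omega_half_eq hL.ne', omegaLine_def]
  have h2 : ((π : ℂ) / -(-(L₂ : ℂ) ^ 2)) ^ (1 / 2 : ℂ) = ((Real.sqrt π / L₂ : ℝ) : ℂ) := by
    rw [neg_neg, show ((π : ℂ) / (L₂ : ℂ) ^ 2) = ((π / L₂ ^ 2 : ℝ) : ℂ) by push_cast; ring,
      show (1 / 2 : ℂ) = ((1 / 2 : ℝ) : ℂ) by push_cast; ring, ← ofReal_cpow (by positivity),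
      ← Real.sqrt_eq_rpow, Real.sqrt_div' _ (by positivity), Real.sqrt_sq hL.le]
  have h3 : cexp (0 - (2 * π * I * (t₀ - x)) ^ 2 / (4 * -(L₂ : ℂ) ^ 2))
      = ((Real.exp (-(π * (x - t₀) / L₂) ^ 2) : ℝ) : ℂ) := by
    rw [ofReal_exp]
    congr 1
    have hL' : (L₂ : ℂ) ≠ 0 := ofReal_ne_zero.mpr hL.ne'
    push_cast
    field_simp
    ring_nf
    rw [I_sq]
    ring
  rw [h2, h3]
  push_cast
  ring

/-! ## `∫ ω(1/2 + 2πix) dx = 1` and the half-line form of Lemma 5.4 (ii) -/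

/-- `omegaLine` as a translate of the centred Gaussian `exp{−(π²/𝓛₂²)y²}`. [folklore] -/
lemma omegaLine_eq_gaussian (L₂ t₀ x : ℝ) :
    omegaLine L₂ t₀ x
      = Real.sqrt π / L₂ * (fun y : ℝ => Real.exp (-(π ^ 2 / L₂ ^ 2) * y ^ 2)) (x - t₀) := by
  rw [omegaLine_def]
  congr 2
  ring

/-- `x ↦ ω(1/2 + 2πix)` is integrable on `ℝ`. [folklore] -/
theorem integrable_omegaLine {L₂ : ℝ} (hL : 0 < L₂) (t₀ : ℝ) : Integrable (omegaLine L₂ t₀) := by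
  have hb : 0 < π ^ 2 / L₂ ^ 2 := by positivity
  have h : omegaLine L₂ t₀
      = fun x => Real.sqrt π / L₂ * (fun y : ℝ => Real.exp (-(π ^ 2 / L₂ ^ 2) * y ^ 2)) (x - t₀) := by
    funext x; exact omegaLine_eq_gaussian L₂ t₀ x
  rw [h]
  exact ((integrable_exp_neg_mul_sq hb).comp_sub_right t₀).const_mul _

/-- `ω(1/2 + 2πix) ≥ 0`. [cite: Zhang2022LandauSiegel, §5 p. 10] -/
lemma omegaLine_nonneg {L₂ : ℝ} (hL : 0 < L₂) (t₀ x : ℝ) : 0 ≤ omegaLine L₂ t₀ x :=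
  (omegaLine_pos hL t₀ x).le

/-- `∫_{−∞}^{∞} ω(1/2 + 2πix) dx = 1`, EXACTLY (the Gaussian integral behind
"`∫₀^∞ ω(1/2+2πix) dx = 1 + O(ε)`" in the proof of Lemma 5.4 (ii)).
[cite: Zhang2022LandauSiegel, §5 Lemma 5.4 (ii) (proof)] -/
theorem integral_omegaLine {L₂ : ℝ} (hL : 0 < L₂) (t₀ : ℝ) : ∫ x : ℝ, omegaLine L₂ t₀ x = 1 := by
  have hb : 0 < π ^ 2 / L₂ ^ 2 := by positivity
  simp_rw [omegaLine_eq_gaussian L₂ t₀]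
  rw [integral_const_mul,
    integral_sub_right_eq_self (fun y : ℝ => Real.exp (-(π ^ 2 / L₂ ^ 2) * y ^ 2)) t₀,
    integral_gaussian]
  have h1 : π / (π ^ 2 / L₂ ^ 2) = L₂ ^ 2 / π := by
    field_simp
  rw [h1, Real.sqrt_div' _ pi_pos.le, Real.sqrt_sq hL.le]
  have hπ : Real.sqrt π ≠ 0 := (Real.sqrt_pos.mpr pi_pos).ne'
  field_simp

/-- The left tail: for `t₀ ≥ 0`, `∫_{−∞}^{0} ω(1/2 + 2πix) dx ≤ ½·exp{−(πt₀/𝓛₂)²}`.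
[cite: Zhang2022LandauSiegel, §5 Lemma 5.4 (ii) (proof)] -/
theorem integral_omegaLine_Iic_le {L₂ : ℝ} (hL : 0 < L₂) {t₀ : ℝ} (ht : 0 ≤ t₀) :
    ∫ x in Iic (0 : ℝ), omegaLine L₂ t₀ x ≤ 1 / 2 * Real.exp (-(π * t₀ / L₂) ^ 2) := by
  have hb : 0 < π ^ 2 / L₂ ^ 2 := by positivity
  set g : ℝ → ℝ := fun y => Real.exp (-(π ^ 2 / L₂ ^ 2) * y ^ 2) with hg
  have hgi : Integrable g := integrable_exp_neg_mul_sq hb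
  have hpt : ∀ x ∈ Iic (0 : ℝ),
      omegaLine L₂ t₀ x ≤ Real.exp (-(π * t₀ / L₂) ^ 2) * (Real.sqrt π / L₂) * g x := by
    intro x hx
    have hxle : x ≤ 0 := hx
    have hxt : x * t₀ ≤ 0 := mul_nonpos_of_nonpos_of_nonneg hxle ht
    rw [omegaLine_def, hg]
    simp only
    rw [mul_comm (Real.exp _) (Real.sqrt π / L₂), mul_assoc, ← Real.exp_add]
    gcongr
    have key : -(π * (x - t₀) / L₂) ^ 2
        = (-(π * t₀ / L₂) ^ 2 + -(π ^ 2 / L₂ ^ 2) * x ^ 2) + 2 * (π ^ 2 / L₂ ^ 2) * (x * t₀) := by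
      field_simp
      ring
    rw [key]
    nlinarith
  have hIic : ∫ x in Iic (0 : ℝ), g x = Real.sqrt (π / (π ^ 2 / L₂ ^ 2)) / 2 := by
    have h1 : ∫ x in Iic (0 : ℝ), g x = ∫ x in Ioi (0 : ℝ), g (-x) := by
      rw [integral_comp_neg_Ioi 0 g, neg_zero]
    rw [h1]
    simp only [hg, even_two.neg_pow]
    exact integral_gaussian_Ioi _
  have h2 : Real.sqrt (π / (π ^ 2 / L₂ ^ 2)) = L₂ / Real.sqrt π := by
    rw [show π / (π ^ 2 / L₂ ^ 2) = L₂ ^ 2 / π by field_simp, Real.sqrt_div' _ pi_pos.le,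
      Real.sqrt_sq hL.le]
  calc ∫ x in Iic (0 : ℝ), omegaLine L₂ t₀ x
      ≤ ∫ x in Iic (0 : ℝ), Real.exp (-(π * t₀ / L₂) ^ 2) * (Real.sqrt π / L₂) * g x :=
        setIntegral_mono_on (integrable_omegaLine hL t₀).integrableOn
          ((hgi.const_mul _).integrableOn) measurableSet_Iic hpt
    _ = Real.exp (-(π * t₀ / L₂) ^ 2) * (Real.sqrt π / L₂) * (L₂ / Real.sqrt π) / 2 := by
        rw [integral_const_mul, hIic, h2]; ring
    _ = 1 / 2 * Real.exp (-(π * t₀ / L₂) ^ 2) := by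
        have hπ : Real.sqrt π ≠ 0 := (Real.sqrt_pos.mpr pi_pos).ne'
        field_simp

/-- `∫₀^∞ ω(1/2+2πix) dx = 1 − ∫_{−∞}^{0} ω(1/2+2πix) dx`. [folklore] -/
theorem integral_omegaLine_Ioi_eq {L₂ : ℝ} (hL : 0 < L₂) (t₀ : ℝ) :
    ∫ x in Ioi (0 : ℝ), omegaLine L₂ t₀ x = 1 - ∫ x in Iic (0 : ℝ), omegaLine L₂ t₀ x := by
  have h := integral_add_compl (measurableSet_Iic (a := (0 : ℝ))) (integrable_omegaLine hL t₀)
  rw [compl_Iic, integral_omegaLine hL] at h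
  linarith

/-- **Lemma 5.4 (ii), last step, upper half**: `∫₀^∞ ω(1/2 + 2πix) dx ≤ 1`.
[cite: Zhang2022LandauSiegel, §5 Lemma 5.4 (ii) (proof)] -/
theorem integral_omegaLine_Ioi_le_one {L₂ : ℝ} (hL : 0 < L₂) (t₀ : ℝ) :
    ∫ x in Ioi (0 : ℝ), omegaLine L₂ t₀ x ≤ 1 := by
  rw [integral_omegaLine_Ioi_eq hL]
  have : 0 ≤ ∫ x in Iic (0 : ℝ), omegaLine L₂ t₀ x :=
    setIntegral_nonneg measurableSet_Iic fun x _ => omegaLine_nonneg hL t₀ x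
  linarith

/-- **Lemma 5.4 (ii), last step, with an explicit tail**: for `t₀ ≥ 0`,
`1 − ½·exp{−(πt₀/𝓛₂)²} ≤ ∫₀^∞ ω(1/2 + 2πix) dx` (the source: "`= 1 + O(ε)`").
[cite: Zhang2022LandauSiegel, §5 Lemma 5.4 (ii) (proof)] -/
theorem one_sub_le_integral_omegaLine_Ioi {L₂ : ℝ} (hL : 0 < L₂) {t₀ : ℝ} (ht : 0 ≤ t₀) :
    1 - 1 / 2 * Real.exp (-(π * t₀ / L₂) ^ 2) ≤ ∫ x in Ioi (0 : ℝ), omegaLine L₂ t₀ x := by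
  rw [integral_omegaLine_Ioi_eq hL]
  have := integral_omegaLine_Iic_le hL ht
  linarith


/-! ## The modulus of `ω` off the critical line and (7.4): `∫_{𝔍(z)} |ω(s) ds| ≪ 1`

§7 p. 13: "Let `𝔍(z)` denote the segment `[s₀+z−i𝓛₁, s₀+z+i𝓛₁]`. […] applying the simple estimate
`∫_{𝔍(z)} |ω(s) ds| ≪ 1`, `|z| ≤ 𝓛⁹`, (7.4)"; the same "simple bound for `ω(s)`" is invoked at (8.1)
(§8 p. 16) and in §6. Here: the modulus of (2.15) in closed form, and (7.4) with the explicit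
constant `2π·exp{z²/(4𝓛₂²)}` (`≤ 2π e^{1/4}` for `|z| ≤ 𝓛₂`; the source's range `|z| ≤ 𝓛⁹` lies
inside `|z| ≤ 𝓛₂ = 𝓛^{400}` — that bookkeeping is not introduced). -/

/-- **The modulus of the weight (2.15)**, EXACT: for `𝓛₂ > 0` and every `s = σ + it`,
`|ω(s)| = (√π/𝓛₂) exp{((σ − 1/2)² − (t − 2πt₀)²)/(4𝓛₂²)}` (the "simple bound for `ω(s)`" of
§§6–8: Gaussian decay in `t` about `2πt₀`, growth `exp{(σ−1/2)²/(4𝓛₂²)}` in `σ`).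
[cite: Zhang2022LandauSiegel, §2 (2.15); §7 (7.4)] -/
theorem norm_omega_eq {L₂ : ℝ} (hL : 0 < L₂) (t₀ : ℝ) (s : ℂ) :
    ‖omega L₂ t₀ s‖
      = Real.sqrt π / L₂ * Real.exp (((s.re - 1 / 2) ^ 2 - (s.im - 2 * π * t₀) ^ 2) / (4 * L₂ ^ 2)) := by
  have hs : s = ((s.re : ℝ) : ℂ) + ((s.im : ℝ) : ℂ) * I := (Complex.re_add_im s).symm
  have h : ((s - s0 t₀) ^ 2 / (4 * (L₂ : ℂ) ^ 2)).re
      = ((s.re - 1 / 2) ^ 2 - (s.im - 2 * π * t₀) ^ 2) / (4 * L₂ ^ 2) := by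
    have hL' : (L₂ : ℂ) ≠ 0 := ofReal_ne_zero.mpr hL.ne'
    have e : (s - s0 t₀) ^ 2 / (4 * (L₂ : ℂ) ^ 2)
        = ((((s.re - 1 / 2) ^ 2 - (s.im - 2 * π * t₀) ^ 2) / (4 * L₂ ^ 2) : ℝ) : ℂ)
          + (((2 * (s.re - 1 / 2) * (s.im - 2 * π * t₀)) / (4 * L₂ ^ 2) : ℝ) : ℂ) * I := by
      conv_lhs => rw [hs]
      rw [s0_def]
      push_cast
      field_simp
      ring_nf
      rw [I_sq]
      ring
    rw [e, add_re, ofReal_re, re_ofReal_mul, I_re, mul_zero, add_zero]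
  rw [omega_def, norm_mul, Complex.norm_real, Real.norm_of_nonneg (by positivity), Complex.norm_exp,
    h]

/-- The modulus of `ω` on the segment `𝔍(z)`: for real `z`, `v`,
`|ω(z + s₀ + iv)| = (√π/𝓛₂) exp{(z² − v²)/(4𝓛₂²)}`. [cite: Zhang2022LandauSiegel, §7 (7.4)] -/
theorem norm_omega_segment_eq {L₂ : ℝ} (hL : 0 < L₂) (t₀ z v : ℝ) :
    ‖omega L₂ t₀ ((z : ℂ) + s0 t₀ + v * I)‖
      = Real.sqrt π / L₂ * Real.exp ((z ^ 2 - v ^ 2) / (4 * L₂ ^ 2)) := by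
  rw [norm_omega_eq hL]
  have hre : ((z : ℂ) + s0 t₀ + v * I).re = z + 1 / 2 := by rw [s0_def]; simp
  have him : ((z : ℂ) + s0 t₀ + v * I).im = 2 * π * t₀ + v := by rw [s0_def]; simp
  rw [hre, him]
  congr 3
  ring

/-- "A simple bound for `ω(s)`" on `𝔍(z)` (§8 (8.1); §7 (7.4)): for real `z`, `v`,
`|ω(z + s₀ + iv)| ≤ (√π/𝓛₂) exp{z²/(4𝓛₂²)}·exp{−v²/(4𝓛₂²)}` (an equality, recorded as the
factorised bound that is integrated in (7.4)). [cite: Zhang2022LandauSiegel, §7 (7.4); §8 (8.1)] -/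
theorem norm_omega_segment_le {L₂ : ℝ} (hL : 0 < L₂) (t₀ z v : ℝ) :
    ‖omega L₂ t₀ ((z : ℂ) + s0 t₀ + v * I)‖
      ≤ Real.sqrt π / L₂ * Real.exp (z ^ 2 / (4 * L₂ ^ 2))
          * Real.exp (-(1 / (4 * L₂ ^ 2)) * v ^ 2) := by
  rw [norm_omega_segment_eq hL, mul_assoc, ← Real.exp_add]
  apply le_of_eq
  congr 2
  ring

/-- **(7.4)**, EXPLICIT: for `𝓛₂ > 0`, `𝓛₁ ≥ 0` and real `z`,
`∫_{𝔍(z)} |ω(s) ds| = ∫_{−𝓛₁}^{𝓛₁} |ω(z + s₀ + iv)| dv ≤ 2π·exp{z²/(4𝓛₂²)}`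
(the full Gaussian integral `∫_ℝ exp{−v²/(4𝓛₂²)} dv = 2√π𝓛₂`).
[cite: Zhang2022LandauSiegel, §7 (7.4)] -/
theorem integral_norm_omega_segment_le {L₂ : ℝ} (hL : 0 < L₂) (t₀ z : ℝ) {L₁ : ℝ}
    (hL₁ : 0 ≤ L₁) :
    ∫ v in (-L₁)..L₁, ‖omega L₂ t₀ ((z : ℂ) + s0 t₀ + v * I)‖
      ≤ 2 * π * Real.exp (z ^ 2 / (4 * L₂ ^ 2)) := by
  have hb : 0 < 1 / (4 * L₂ ^ 2) := by positivity
  set g : ℝ → ℝ := fun v => Real.exp (-(1 / (4 * L₂ ^ 2)) * v ^ 2) with hg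
  have hgi : Integrable g := integrable_exp_neg_mul_sq hb
  set C : ℝ := Real.sqrt π / L₂ * Real.exp (z ^ 2 / (4 * L₂ ^ 2)) with hC
  have hC0 : 0 ≤ C := by positivity
  have hpt : ∀ v : ℝ, ‖omega L₂ t₀ ((z : ℂ) + s0 t₀ + v * I)‖ = C * g v := by
    intro v
    rw [norm_omega_segment_eq hL, hC, hg, mul_assoc, ← Real.exp_add]
    congr 2
    ring
  simp_rw [hpt]
  rw [intervalIntegral.integral_const_mul]
  -- the segment integral of the Gaussian is at most the full one, `2√π𝓛₂`
  have hle : ∫ v in (-L₁)..L₁, g v ≤ ∫ v, g v := by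
    rw [intervalIntegral.integral_of_le (by linarith)]
    exact setIntegral_le_integral hgi (Filter.Eventually.of_forall fun v => (Real.exp_pos _).le)
  have hfull : ∫ v, g v = 2 * L₂ * Real.sqrt π := by
    rw [hg, integral_gaussian, show π / (1 / (4 * L₂ ^ 2)) = (2 * L₂) ^ 2 * π by field_simp; ring,
      Real.sqrt_mul (by positivity) π, Real.sqrt_sq (by positivity)]
  rw [hfull] at hle
  calc C * ∫ v in (-L₁)..L₁, g v ≤ C * (2 * L₂ * Real.sqrt π) := by gcongr
    _ = 2 * π * Real.exp (z ^ 2 / (4 * L₂ ^ 2)) := by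
        rw [hC, show Real.sqrt π / L₂ * Real.exp (z ^ 2 / (4 * L₂ ^ 2)) * (2 * L₂ * Real.sqrt π)
            = 2 * (Real.sqrt π * Real.sqrt π) * Real.exp (z ^ 2 / (4 * L₂ ^ 2)) * (L₂ / L₂) by ring,
          Real.mul_self_sqrt pi_pos.le, div_self hL.ne']
        ring

/-- **(7.4) "`∫_{𝔍(z)} |ω(s) ds| ≪ 1`"** with an absolute constant on `|z| ≤ 𝓛₂`: for `𝓛₂ > 0`,
`𝓛₁ ≥ 0` and real `z` with `|z| ≤ 𝓛₂`, `∫_{−𝓛₁}^{𝓛₁} |ω(z + s₀ + iv)| dv ≤ 2π e^{1/4}` (the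
source's range `|z| ≤ 𝓛⁹` is inside `|z| ≤ 𝓛₂ = 𝓛^{400}`). [cite: Zhang2022LandauSiegel, §7 (7.4)] -/
theorem integral_norm_omega_segment_le_of_abs_le {L₂ : ℝ} (hL : 0 < L₂) (t₀ : ℝ) {z L₁ : ℝ}
    (hz : |z| ≤ L₂) (hL₁ : 0 ≤ L₁) :
    ∫ v in (-L₁)..L₁, ‖omega L₂ t₀ ((z : ℂ) + s0 t₀ + v * I)‖ ≤ 2 * π * Real.exp (1 / 4) := by
  refine (integral_norm_omega_segment_le hL t₀ z hL₁).trans ?_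
  gcongr 2 * π * Real.exp ?_
  have hz2 : z ^ 2 ≤ L₂ ^ 2 := by
    rw [← sq_abs z]
    exact pow_le_pow_left₀ (abs_nonneg z) hz 2
  rw [div_le_iff₀ (by positivity)]
  linarith

end SmoothWeight

end Literature.NumberTheory.LFunctions.Zhang2022
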